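import Summits.ABC.Harvest.OpenQuestionsGlue
import Literature.NumberTheory.EllipticCurves.CongruenceNumberLevelBoundProofs
import Literature.NumberTheory.EllipticCurves.CuspFormLFunctionLevelConductorProofs
import Literature.NumberTheory.EllipticCurves.ModularParametrizationBCDTProofs
import HarnessLib

/-!
# ABC harvest 2015–2026: the modular-degree door reaches the Height conjecture (glue, part 2)

`Summits/ABC/Harvest/OpenQuestionsGlueDegree.lean` — cell `abc-harv` (seat typ-1), namespace
`Summit.ABC.Harvest`. Second SORRY-FREE glue file for `OpenQuestions.lean` (split off
`OpenQuestionsGlue.lean` for the 400-line cap on files with proofs): rows H-001/H-020/H-022/H-309.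

* `heightConjecture_of_modularDegreeConjecture` — **`ModularDegreeConjecture ⟹ HeightConjecture` (Pasten 2024
  Conj. 3.2 ⟹ Conj. 3.1, his (3.4); Murty–Pasten 2013 Thm 4.5), PROVED MODULO exactly two named tree facts**:
  modularity with an integral Manin constant (`ModularForms.nonempty_modularParametrizationData`; Wiles–BCDT +
  Edixhoven) and Mazur–Kenku (`ModularForms.PastenShimura2024_minimalDegree_le_163_mul`). The proof is the
  Murty–Pasten §6 chain ALREADY RUN in the tree for `log m_f ≤ (1/5) N log N`
  (`MurtyPasten.faltingsHeight_lt_of_modularity_of_log_modularDegree_le`, `CongruenceNumberLevelBoundProofs.lean`),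
  with `K log N + C` in place of `(1/5) N log N`: a global minimal model (`hasGlobalMinimalModel_rat_holds`,
  `faltingsHeight_smul`, `conductorNorm_smul_rat`), a datum of minimal degree, the class bound
  `minModularDegree ≤ 163 · m_f` (`Pasten2024.log_minModularDegree_le_of_class_bound`), Zagier's identity with the
  trivial Petersson bound (`Pasten2024.twelve_mul_neronLatticeHeight_le`, `log_four_pi_sq_mul_trivialPeterssonConst`)
  — and, to discharge the conductor guard of `ModularDegreeConjecture` at the class-minimal datum, strong
  multiplicity one across levels (`IsNewformOf.level_eq_conductorNorm_of_exists_conductorLevel`, Atkin–Lehner)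
  applied to a (modular) minimal model of that curve (`IsNewformOf.of_smul`). Constant: `h_F ≤ (K/2) log N +
  (C+1)/2 + 11`. (The abc-an cell's `Summit.ABC.Analytic.polyFaltingsHeightRat_of_polyModularDegreeRat`,
  `Requirements.lean` p546687, proves the Zagier step in the ∃-datum-on-a-minimal-model idiom; the bridge between
  the two idioms is filed separately once that module is built on the farm.)
* `modularDegreeIffHeight_mp` — the forward half of the structure question `ModularDegreeIffHeight` (row H-309).

Downstream (part 1 / part 3): `HeightConjecture ⟹ Summit.ABC.PolySzpiroRat` («NOT abc — POLY-SZPIRO(6K)» from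
Conj. 3.2; Pasten §1.4 «such a bound would imply Szpiro's conjecture!» for `D = 1`, in kernel modulo the two facts).

HONESTY LINE: abc is not proved by any of this; A-PS is NOT abc — «NOT abc — POLY-SZPIRO(E)»; the two
hypotheses are NAMED, UNDISCHARGED tree facts (printed theorems); PROVED-MOD-FACTS ≠ proved; typed ≠ proved.
No `sorry`, no axiom, no new definition.
-/

noncomputable section

namespace Summit.ABC.Harvest

open WeierstrassCurve
open Literature.NumberTheory.EllipticCurves
open Literature.NumberTheory.EllipticCurves.ModularForms
open Literature.NumberTheory.EllipticCurves.Pasten2024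
open Literature.NumberTheory.DiophantineGeometry
open ModularForm CongruenceSubgroup
open scoped MatrixGroups

/-- **GLUE (PROVED MODULO TWO NAMED FACTS): the modular degree conjecture (Pasten Conj. 3.2, plain form; Murty–Pasten
«`log m_f ≪ log N` is due to Frey») ⟹ the Height conjecture (Pasten Conj. 3.1 / Murty–Pasten Conj. 1.3)** —
Pasten 2024 §3 (3.4) «`h(E) ≤ h(A_{1,N}) + 3 ≤ ½ log δ_{1,N} + 9`. Thus, the height conjecture (and hence, Szpiro's
conjecture) would follow from [Conj. 3.2]»; Murty–Pasten 2013 Thm 4.5 / Prop. 6.3. Hypotheses: `hmod` = modularity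
with an integral Manin constant (`nonempty_modularParametrizationData`), `h163` = Mazur–Kenku
(`PastenShimura2024_minimalDegree_le_163_mul`) — the same two named facts as the tree's
`MurtyPasten.faltingsHeight_lt_of_modularity_of_log_modularDegree_le`, whose proof this one follows line by line.
Output: `h_F(E) ≤ (K/2)·log N_E + ((C+1)/2 + 11)` for every elliptic `E/ℚ`. «NOT abc — POLY-SZPIRO(6K)» downstream.
[cite: PastenShimura2024, §3 (3.4) and Conj. 3.2 (p. 13)] [cite: MurtyPasten2013, Thm 4.5 (p. 3748) and Prop. 6.3, Thm 7.1 proof (p. 3751–3752)]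
[cite: AtkinLehner1970, Thm. 4] -/
theorem heightConjecture_of_modularDegreeConjecture
    (hmod : nonempty_modularParametrizationData)
    (h163 : PastenShimura2024_minimalDegree_le_163_mul)
    (h : ModularDegreeConjecture) : HeightConjecture := by
  obtain ⟨K, C₀, hKC⟩ := h
  refine ⟨K / 2, (C₀ + 1) / 2 + 11, fun W _ => ?_⟩
  -- pass to a global minimal model `C • W`
  obtain ⟨C, hC⟩ := hasGlobalMinimalModel_rat_holds W
  haveI := hC
  have hN : (C • W).conductorNorm ℤ = W.conductorNorm ℤ := conductorNorm_smul_rat W C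
  haveI : NeZero ((C • W).conductorNorm ℤ) := ⟨(conductorNorm_pos_holds (C • W)).ne'⟩
  rw [← faltingsHeight_smul W C, ← hN]
  set N : ℕ := (C • W).conductorNorm ℤ with hNdef
  have hN1 : (1 : ℝ) ≤ (N : ℝ) := by exact_mod_cast conductorNorm_pos_holds (C • W)
  -- a datum of minimal degree for the minimal model, and the class bound from the conjecture
  obtain ⟨D, hDmin⟩ := exists_modularDegree_eq_minModularDegree (hmod (C • W))
  have hDmin' : D.deg = minModularDegree (C • W) N := hDmin
  have hclass := log_minModularDegree_le_of_class_bound h163 (hmod (C • W))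
    (B := K * Real.log N + C₀ + 1)
    (fun W₀ _ D₀ hmin => by
      -- the level `N` is the conductor of `W₀` (modularity of a minimal model of `W₀` + strong
      -- multiplicity one across levels)
      haveI : NeZero (W₀.conductorNorm ℤ) := ⟨(conductorNorm_pos_holds W₀).ne'⟩
      obtain ⟨C₁, hC₁⟩ := hasGlobalMinimalModel_rat_holds W₀
      haveI := hC₁
      haveI : NeZero ((C₁ • W₀).conductorNorm ℤ) := ⟨(conductorNorm_pos_holds (C₁ • W₀)).ne'⟩
      obtain ⟨D'⟩ := hmod (C₁ • W₀)
      have hW₀ : ∃ g : CuspForm (Gamma0 (W₀.conductorNorm ℤ)) 2, IsNewformOf W₀ g :=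
        exists_isNewformOf_of_level_eq (conductorNorm_smul_rat W₀ C₁)
          ⟨D'.f, IsNewformOf.of_smul C₁ D'.isNewformOf⟩
      have hlev : N = W₀.conductorNorm ℤ :=
        IsNewformOf.level_eq_conductorNorm_of_exists_conductorLevel hW₀ D₀.isNewformOf
      have := hKC W₀ N D₀ hlev.symm hmin
      linarith)
  -- `12 h ≤ 6 log deg − 6 log(4π² c₀)` with the trivial Petersson constant
  have hc₀ : (0 : ℝ) < Real.exp (-(4 * Real.pi)) / (4 * Real.pi) := by positivity
  have hh := twelve_mul_neronLatticeHeight_le D hc₀ D.isNewformOf.peterssonProduct_re_ge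
  rw [log_four_pi_sq_mul_trivialPeterssonConst] at hh
  have hheight : (C • W).faltingsHeight = neronLatticeHeight D.L := by
    rw [D.faltingsHeight_eq, neronLatticeHeight]
  have hdeg : Real.log (D.deg : ℝ) ≤ Real.log 163 + (K * Real.log N + C₀ + 1) := by
    rw [hDmin']; exact hclass
  have h163' : Real.log 163 ≤ 8 * Real.log 2 := by
    rw [← Real.log_rpow (by norm_num), show ((2 : ℝ) ^ (8 : ℝ)) = 256 by norm_num]
    exact Real.log_le_log (by norm_num) (by norm_num)
  have hl2 := Real.log_two_lt_d9
  have hlogpi : 0 ≤ Real.log Real.pi := Real.log_nonneg (by linarith [Real.pi_gt_three])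
  have hpi := Real.pi_le_four
  rw [hheight]
  linarith

/-- **The forward half of Pasten's structure question** (row H-309, `ModularDegreeIffHeight`): modulo
modularity and Mazur–Kenku, Conj. 3.2 ⟹ Conj. 3.1. The converse half is the open part («at present it is
not clear», Remark 3.3). [cite: PastenShimura2024, Remark 3.3 (§3, p. 13)] -/
theorem modularDegreeIffHeight_mp
    (hmod : nonempty_modularParametrizationData)
    (h163 : PastenShimura2024_minimalDegree_le_163_mul) :
    ModularDegreeConjecture → HeightConjecture :=
  heightConjecture_of_modularDegreeConjecture hmod h163

end Summit.ABC.Harvest
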